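import Literature.Barriers.QuantumAdvantage.PBlockedSimIdealTables
import Literature.Barriers.QuantumAdvantage.BoundedEntanglementSimLemmas
import Literature.Barriers.QuantumAdvantage.BoundedEntanglementReadout
import HarnessLib

/-!
# The `p`-blocked simulator: the run computes the block structure, the block data and the decision

Topic `Literature/Barriers/QuantumAdvantage`; machine half of the proof programme for
`Literature.Barriers.QuantumAdvantage.jozsaLinden2003_pblocked` (Jozsa–Linden 2003, §3). On an
oracle-free Clifford+`T` family all of whose states are `p`-blocked, and with a saturation width
`W ≥ h + 2`, the program `PBlockedSim.lean` run on the gate list of the `|x|`-th circuit maintains the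
invariant "the state is `(2^{hExp j}, L.map (blkOf p (ampZ F x j)))` for a duplicate-free listing `L` of
`blocksAfter F x j`" (`blkOf p c B = (maskOf B, tabOf p B c)`), and its read-out is the decision bit
`pDecision F x` of `BoundedEntanglementReadout.lean`:

* `dedupG` (generic `dedupL`), `nodup_dedupG`, `mem_dedupG`, `dedupG_map_of_injective`; `blkOf`, `gateT`
  (the program's view `(opNum, wire₀, wire₁)` of a placed gate), `touches_blkOf`, `foldl_bor_blkOf`;
* **`newBlocks_eq`** — the re-blocking step lists the atoms of the new state inside the merged wires with
  their ideal tables (`firstNonzeroDiag_tabOf`, `splitsTest_tabOf`, `mem_atom_stateAfter_succ_iff`,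
  `capZ_traceEntry_tabOf`);
* **`roundSim_step`** — one gate preserves the invariant (`mergeTab_tabOf`, `gateTab_tabOf`,
  `tabOf_ampZ_succ_of_disjoint`, `blocksAfter_succ`);
* `initBlocks_eq` (`gramZ_singleton_dpInit`), `runSim_eq`, `readout_eq_pDecision`, and
  **`simDecide_eq_pDecision`**:
  `simDecide p W |x| m (gates.map gateT) x = pDecision F x` whenever `hExp + 2 ≤ W`.

## References

* R. Jozsa, N. Linden, *On the role of entanglement in quantum-computational speed-up*, Proc. R. Soc.
  Lond. A 459 (2003) 2011–2032, arXiv:quant-ph/0201143: §3, proof of lemma `ratpbl` ((a), (b), Cases 1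
  and 2, the read-out), theorem `pblthm`.
-/

noncomputable section

namespace Literature.Barriers.QuantumAdvantage

namespace PSim

open Finset Literature.Computability.Cryptography Literature.Computability.QuantumComplexity

variable {N : ℕ}

/-! ### Removing duplicates -/

/-- `dedupL` at any type: keep first occurrences. [folklore] -/
def dedupG {α : Type} [DecidableEq α] (l : List α) : List α :=
  l.foldl (fun acc a => if a ∈ acc then acc else acc ++ [a]) []

/-- The fold behind `dedupG` from an arbitrary accumulator. [folklore] -/
theorem foldl_dedup_spec {α : Type} [DecidableEq α] (l acc : List α) (hacc : acc.Nodup) :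
    (l.foldl (fun acc a => if a ∈ acc then acc else acc ++ [a]) acc).Nodup ∧
      ∀ b, b ∈ l.foldl (fun acc a => if a ∈ acc then acc else acc ++ [a]) acc ↔ b ∈ acc ∨ b ∈ l := by
  induction l generalizing acc with
  | nil => exact ⟨hacc, fun b => by simp⟩
  | cons a l ih =>
    rw [List.foldl_cons]
    by_cases ha : a ∈ acc
    · rw [if_pos ha]
      obtain ⟨h1, h2⟩ := ih acc hacc
      refine ⟨h1, fun b => ?_⟩
      rw [h2]
      constructor
      · rintro (h | h)
        · exact Or.inl h
        · exact Or.inr (List.mem_cons_of_mem _ h)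
      · rintro (h | h)
        · exact Or.inl h
        · rcases List.mem_cons.1 h with rfl | h
          · exact Or.inl ha
          · exact Or.inr h
    · rw [if_neg ha]
      have hacc' : (acc ++ [a]).Nodup := by
        rw [List.nodup_append]
        exact ⟨hacc, List.nodup_singleton a, fun b hb c hc => by
          rw [List.mem_singleton] at hc; rintro rfl; exact ha (hc ▸ hb)⟩
      obtain ⟨h1, h2⟩ := ih (acc ++ [a]) hacc'
      refine ⟨h1, fun b => ?_⟩
      rw [h2, List.mem_append, List.mem_singleton, List.mem_cons]
      tauto

/-- `dedupG` is duplicate-free. [folklore] -/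
theorem nodup_dedupG {α : Type} [DecidableEq α] (l : List α) : (dedupG l).Nodup :=
  (foldl_dedup_spec l [] List.nodup_nil).1

/-- `dedupG` has the same members. [folklore] -/
@[simp] theorem mem_dedupG {α : Type} [DecidableEq α] {l : List α} {b : α} : b ∈ dedupG l ↔ b ∈ l := by
  rw [dedupG, (foldl_dedup_spec l [] List.nodup_nil).2 b]
  simp

/-- `dedupG` commutes with injective maps. [folklore] -/
theorem dedupG_map_of_injective {α β : Type} [DecidableEq α] [DecidableEq β] {f : α → β} (hf : Function.Injective f)
    (l : List α) : dedupG (l.map f) = (dedupG l).map f := by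
  suffices h : ∀ acc : List α, (l.map f).foldl (fun acc a => if a ∈ acc then acc else acc ++ [a]) (acc.map f) =
      (l.foldl (fun acc a => if a ∈ acc then acc else acc ++ [a]) acc).map f by
    simpa [dedupG] using h []
  induction l with
  | nil => intro acc; rfl
  | cons a l ih =>
    intro acc
    rw [List.map_cons, List.foldl_cons, List.foldl_cons]
    by_cases ha : a ∈ acc
    · rw [if_pos ((List.mem_map_of_injective hf).2 ha), if_pos ha, ih]
    · rw [if_neg (fun h => ha ((List.mem_map_of_injective hf).1 h)), if_neg ha, ← ih (acc ++ [a]), List.map_append,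
        List.map_singleton]

/-- `dedupL` is `dedupG` (the two differ only in the decidability instance of membership). [folklore] -/
theorem dedupL_eq_dedupG (l : List Cfg) : dedupL l = dedupG l := by
  simp only [dedupL, dedupG]
  congr 1
  funext acc a
  by_cases h : a ∈ acc <;> simp [h]

/-! ### Blocks and gates as the program sees them -/

/-- The program's block of a wire set: its mask with its ideal table. [cite: JozsaLinden2003, §3 (proof of lemma ratpbl, (a), (b))] -/
def blkOf (p : ℕ) (c : QReg N → ZW) (B : Finset (Fin N)) : Blk := (maskOf B, tabOf p B c)

/-- `blkOf` is injective in the wire set. [folklore] -/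
theorem blkOf_injective (p : ℕ) (c : QReg N → ZW) : Function.Injective (blkOf p c) :=
  fun _ _ h => maskOf_injective (congrArg Prod.fst h)

/-- The program's view of a placed gate: `(symbol number, first wire, second wire)`. [folklore] -/
def gateT : QGate cliffordT N → ℕ × ℕ × ℕ
  | .gate op e => (opNum op, wireIdx op e 0, wireIdx op e 1)
  | .oracle _ _ => (0, 0, 0)

/-- `opNum op = 3` iff the gate is `CNOT`. [folklore] -/
theorem opNum_eq_three_iff (op : CliffordTOp) : opNum op = 3 ↔ op = .CNOT := by
  cases op <;> simp [opNum]

/-- `opNum op = 0` iff the gate is `H`. [folklore] -/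
theorem opNum_eq_zero_iff (op : CliffordTOp) : opNum op = 0 ↔ op = .H := by
  cases op <;> simp [opNum]

/-- **Which blocks the program deems touching**: exactly those meeting the wires of the gate. [folklore] -/
theorem touches_blkOf (p : ℕ) (c : QReg N → ZW) (op : CliffordTOp) (e : Fin (cliffordT.arity op) ↪ Fin N)
    (B : Finset (Fin N)) :
    touches (opNum op) (wireIdx op e 0) (wireIdx op e 1) (blkOf p c B) =
      decide ((B ∩ (QGate.gate op e : QGate cliffordT N).wires).Nonempty) := by
  have key : (B ∩ (QGate.gate op e : QGate cliffordT N).wires).Nonempty ↔ ∃ k, e k ∈ B := by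
    constructor
    · rintro ⟨i, hi⟩
      rw [mem_inter, mem_wires_gate_iff] at hi
      obtain ⟨hiB, k, rfl⟩ := hi
      exact ⟨k, hiB⟩
    · rintro ⟨k, hk⟩
      exact ⟨e k, mem_inter.2 ⟨hk, (mem_wires_gate_iff op e _).2 ⟨k, rfl⟩⟩⟩
  rw [touches, blkOf]
  apply Bool.eq_iff_iff.2
  rw [decide_eq_true_eq, key, Bool.or_eq_true, Bool.and_eq_true, decide_eq_true_eq, opNum_eq_three_iff]
  cases op with
  | H =>
    let i₀ : Fin (cliffordT.arity .H) := ⟨0, Nat.one_pos⟩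
    have h0 : wireIdx .H e 0 = ((e i₀ : Fin N) : ℕ) := by simp [wireIdx, i₀]; rfl
    rw [h0, getD_maskOf_fin, decide_eq_true_eq]
    constructor
    · rintro (h | ⟨h, -⟩)
      · exact ⟨i₀, h⟩
      · exact absurd h (by decide)
    · rintro ⟨k, hk⟩
      left
      have : k = i₀ := Subsingleton.elim (α := Fin 1) k i₀
      rwa [this] at hk
  | S =>
    let i₀ : Fin (cliffordT.arity .S) := ⟨0, Nat.one_pos⟩
    have h0 : wireIdx .S e 0 = ((e i₀ : Fin N) : ℕ) := by simp [wireIdx, i₀]; rfl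
    rw [h0, getD_maskOf_fin, decide_eq_true_eq]
    constructor
    · rintro (h | ⟨h, -⟩)
      · exact ⟨i₀, h⟩
      · exact absurd h (by decide)
    · rintro ⟨k, hk⟩
      left
      have : k = i₀ := Subsingleton.elim (α := Fin 1) k i₀
      rwa [this] at hk
  | T =>
    let i₀ : Fin (cliffordT.arity .T) := ⟨0, Nat.one_pos⟩
    have h0 : wireIdx .T e 0 = ((e i₀ : Fin N) : ℕ) := by simp [wireIdx, i₀]; rfl
    rw [h0, getD_maskOf_fin, decide_eq_true_eq]
    constructor
    · rintro (h | ⟨h, -⟩)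
      · exact ⟨i₀, h⟩
      · exact absurd h (by decide)
    · rintro ⟨k, hk⟩
      left
      have : k = i₀ := Subsingleton.elim (α := Fin 1) k i₀
      rwa [this] at hk
  | CNOT =>
    let i₀ : Fin (cliffordT.arity .CNOT) := ⟨0, by decide⟩
    let i₁ : Fin (cliffordT.arity .CNOT) := ⟨1, by decide⟩
    have h0 : wireIdx .CNOT e 0 = ((e i₀ : Fin N) : ℕ) := by simp [wireIdx, i₀]; rfl
    have h1 : wireIdx .CNOT e 1 = ((e i₁ : Fin N) : ℕ) := by simp [wireIdx, i₁]; rfl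
    rw [h0, h1, getD_maskOf_fin, getD_maskOf_fin, decide_eq_true_eq, decide_eq_true_eq]
    constructor
    · rintro (h | ⟨-, h⟩)
      · exact ⟨i₀, h⟩
      · exact ⟨i₁, h⟩
    · rintro ⟨k, hk⟩
      have : k = i₀ ∨ k = i₁ := by
        rcases k with ⟨k, hk'⟩
        have : k < 2 := hk'
        interval_cases k
        · exact Or.inl rfl
        · exact Or.inr rfl
      rcases this with rfl | rfl
      · exact Or.inl hk
      · exact Or.inr ⟨rfl, hk⟩

/-- Folding `bor` over the masks of program blocks is the mask of the union. [folklore] -/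
theorem foldl_bor_blkOf (p : ℕ) (c : QReg N → ZW) (L : List (Finset (Fin N))) (S₀ : Finset (Fin N)) :
    (L.map (blkOf p c)).foldl (fun acc b => bor acc b.1) (maskOf S₀) = maskOf (L.foldl (fun acc B => acc ∪ B) S₀) := by
  induction L generalizing S₀ with
  | nil => rfl
  | cons B L ih => rw [List.map_cons, List.foldl_cons, List.foldl_cons, blkOf, bor_maskOf, ih]

/-- Folding unions is the `sup` of the listed sets. [folklore] -/
theorem foldl_union_eq (L : List (Finset (Fin N))) (S₀ : Finset (Fin N)) :
    L.foldl (fun acc B => acc ∪ B) S₀ = S₀ ∪ L.toFinset.sup id := by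
  induction L generalizing S₀ with
  | nil => simp
  | cons B L ih => rw [List.foldl_cons, ih, List.toFinset_cons, sup_insert, id, union_assoc]; rfl

/-! ### The re-blocking step -/

/-- The support of a configuration of `cfg C` lies in `C`. [folklore] -/
theorem maskSet_ofReg_subset {C : Finset (Fin N)} {y : QReg N} (hy : y ∈ cfg C) : maskSet N (ofReg y) ⊆ C := by
  intro i hi
  rw [maskSet_ofReg, mem_filter] at hi
  by_contra h
  rw [mem_cfg.1 hy i h] at hi
  exact Bool.false_ne_true hi.2

/-- The indicator of a subset of `C` is a configuration of `cfg C` with that support. [folklore] -/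
theorem maskOf_eq_ofReg_indicator (S : Finset (Fin N)) : maskOf S = ofReg fun i => decide (i ∈ S) := rfl

/-- The indicator of `S ⊆ C` lies in `cfg C`. [folklore] -/
theorem indicator_mem_cfg {S C : Finset (Fin N)} (hS : S ⊆ C) : (fun i => decide (i ∈ S)) ∈ cfg C :=
  mem_cfg.2 fun i hi => by simpa using fun h => hi (hS h)

/-- The class fold of the program over a list of masks is the mask of the intersection. [folklore] -/
theorem classOf_map_maskOf (C : Finset (Fin N)) (Lsub : List (Finset (Fin N))) {a : ℕ} (ha : a < N) :
    classOf (maskOf C) (Lsub.map maskOf) a =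
      maskOf (Lsub.foldl (fun acc S => if (⟨a, ha⟩ : Fin N) ∈ S then acc ∩ S else acc) C) := by
  rw [classOf]
  induction Lsub generalizing C with
  | nil => rfl
  | cons S L ih =>
    rw [List.map_cons, List.foldl_cons, List.foldl_cons, getD_maskOf, dif_pos ha]
    by_cases hS : (⟨a, ha⟩ : Fin N) ∈ S
    · rw [decide_eq_true hS, if_pos rfl, if_pos hS, band_maskOf, ih]
    · rw [decide_eq_false hS, if_neg Bool.false_ne_true, if_neg hS, ih]

/-- Membership in the intersection fold. [folklore] -/
theorem mem_foldl_inter_iff (Lsub : List (Finset (Fin N))) (C : Finset (Fin N)) (a k : Fin N) :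
    k ∈ Lsub.foldl (fun acc S => if a ∈ S then acc ∩ S else acc) C ↔ k ∈ C ∧ ∀ S ∈ Lsub, a ∈ S → k ∈ S := by
  induction Lsub generalizing C with
  | nil => simp
  | cons S L ih =>
    rw [List.foldl_cons, ih]
    simp only [List.mem_cons, forall_eq_or_imp]
    by_cases ha : a ∈ S
    · rw [if_pos ha, mem_inter]; tauto
    · rw [if_neg ha]; tauto

section Family

variable (F : QCircuitFamily cliffordT) (x : List Bool)

/-- **The re-blocking step on the ideal table of the merged wires** lists the atoms of the new state
inside them, each once, with their ideal tables. [cite: JozsaLinden2003, §3 (proof of lemma ratpbl, Case 2: "identify a new block structure")] -/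
theorem newBlocks_eq (hF : F.IsOracleFree) {p : ℕ} (hp : F.HasPBlockedStates p) {j W : ℕ}
    (hj : j < (F.circ x.length).gates.length) (hW : F.hExp x (j + 1) + 2 ≤ W)
    {C : Finset (Fin (x.length + F.ancillas x.length))}
    (hCeq : C = touchUnion (blocksAfter F x j) ((F.circ x.length).gates[j]).wires) :
    ∃ Lnew : List (Finset (Fin (x.length + F.ancillas x.length))), Lnew.Nodup ∧
      Lnew.toFinset = C.image (fun i => atom (F.stateAfter x (j + 1)) i) ∧
      (∀ A ∈ Lnew, A ⊆ C ∧ A.Nonempty) ∧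
      newBlocks p (x.length + F.ancillas x.length) W (maskOf C) (subCfgs p (maskOf C)) (tabOf p C (F.ampZ x (j + 1))) =
        Lnew.map (blkOf p (F.ampZ x (j + 1))) := by
  have hC : C.card ≤ 2 * p := hCeq ▸ card_touchUnion_blocksAfter_le hF hp j hj
  have hCs : Splits (F.stateAfter x (j + 1)) C := hCeq ▸ splits_touchUnion_succ hF hj
  obtain ⟨y₀, hy₀C, hy₀eq, hy₀⟩ := firstNonzeroDiag_tabOf F x hF (j + 1) hC (p := p)
  -- the splitting sub-masks
  obtain ⟨Ls, hLs⟩ : ∃ Ls : List Cfg, Ls = (subCfgs p (maskOf C)).filter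
      (fun S => splitsTest (subCfgs p (maskOf C)) (tabOf p C (F.ampZ x (j + 1))) (ofReg y₀) S) := ⟨_, rfl⟩
  have hLs_mem : ∀ S, S ∈ Ls ↔ ∃ S' ⊆ C, S = maskOf S' ∧ Splits (F.stateAfter x (j + 1)) S' := by
    intro S
    rw [hLs, List.mem_filter, mem_subCfgs_maskOf_iff hC]
    constructor
    · rintro ⟨⟨yS, hyS, rfl⟩, ht⟩
      refine ⟨maskSet _ (ofReg yS), maskSet_ofReg_subset hyS, (maskOf_maskSet (length_ofReg yS)).symm, ?_⟩
      rw [← maskOf_maskSet (length_ofReg yS) (N := x.length + F.ancillas x.length)] at ht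
      exact (splitsTest_tabOf F x hF hCs hC hy₀C hy₀ (maskSet_ofReg_subset hyS)).1 ht
    · rintro ⟨S', hS'C, rfl, hsp⟩
      exact ⟨⟨_, indicator_mem_cfg hS'C, rfl⟩, (splitsTest_tabOf F x hF hCs hC hy₀C hy₀ hS'C).2 hsp⟩
  obtain ⟨Lsub, hLsub⟩ : ∃ Lsub : List (Finset (Fin (x.length + F.ancillas x.length))), Lsub = Ls.map (maskSet _) := ⟨_, rfl⟩
  have hLs_eq : Ls = Lsub.map maskOf := by
    rw [hLsub, List.map_map]
    refine (List.map_id _).symm.trans (List.map_congr_left fun S hS => ?_)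
    obtain ⟨S', -, rfl, -⟩ := (hLs_mem S).1 hS
    simp
  have hLsub_mem : ∀ S', S' ∈ Lsub ↔ S' ⊆ C ∧ Splits (F.stateAfter x (j + 1)) S' := by
    intro S'
    constructor
    · intro h
      have : maskOf S' ∈ Ls := by rw [hLs_eq]; exact List.mem_map.2 ⟨S', h, rfl⟩
      obtain ⟨S'', hS''C, he, hsp⟩ := (hLs_mem _).1 this
      rw [maskOf_injective he]; exact ⟨hS''C, hsp⟩
    · rintro ⟨hS'C, hsp⟩
      have : maskOf S' ∈ Ls := (hLs_mem _).2 ⟨S', hS'C, rfl, hsp⟩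
      rw [hLs_eq] at this
      obtain ⟨S'', hS'', he⟩ := List.mem_map.1 this
      rwa [← maskOf_injective he]
  -- the class of a wire of `C` is its atom
  have hclass : ∀ (a : ℕ) (ha : a < x.length + F.ancillas x.length), (⟨a, ha⟩ : Fin _) ∈ C →
      classOf (maskOf C) Ls a = maskOf (atom (F.stateAfter x (j + 1)) ⟨a, ha⟩) := by
    intro a ha haC
    rw [hLs_eq, classOf_map_maskOf C Lsub ha]
    congr 1
    ext k
    rw [mem_foldl_inter_iff, mem_atom_stateAfter_succ_iff F x hF hj (hCeq ▸ haC), ← hCeq]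
    simp only [hLsub_mem]
    constructor
    · rintro ⟨-, h⟩ S hSC hsp haS
      exact h S ⟨hSC, hsp⟩ haS
    · intro h
      exact ⟨h C subset_rfl hCs haC, fun S hS haS => h S hS.1 hS.2 haS⟩
  -- the wires of `C` as naturals
  obtain ⟨Lw, hLw⟩ : ∃ Lw : List ℕ, Lw = (List.range (x.length + F.ancillas x.length)).filter
      fun a => (maskOf C).getD a false := ⟨_, rfl⟩
  have hLw_mem : ∀ a, a ∈ Lw ↔ ∃ h : a < x.length + F.ancillas x.length, (⟨a, h⟩ : Fin _) ∈ C := by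
    intro a
    rw [hLw, List.mem_filter, List.mem_range, getD_maskOf]
    constructor
    · rintro ⟨ha, h⟩
      rw [dif_pos ha, decide_eq_true_eq] at h
      exact ⟨ha, h⟩
    · rintro ⟨ha, h⟩
      exact ⟨ha, by rw [dif_pos ha, decide_eq_true_eq]; exact h⟩
  obtain ⟨atomN, hatomN⟩ : ∃ atomN : ℕ → Finset (Fin (x.length + F.ancillas x.length)),
      atomN = fun a => if h : a < x.length + F.ancillas x.length then atom (F.stateAfter x (j + 1)) ⟨a, h⟩ else ∅ := ⟨_, rfl⟩
  have hatomN_apply : ∀ {a : ℕ} (ha : a < x.length + F.ancillas x.length), atomN a = atom (F.stateAfter x (j + 1)) ⟨a, ha⟩ :=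
    fun ha => by rw [hatomN]; exact dif_pos ha
  have hmapcls : Lw.map (fun a => classOf (maskOf C) Ls a) = (Lw.map atomN).map maskOf := by
    rw [List.map_map]
    refine List.map_congr_left fun a ha => ?_
    obtain ⟨ha', haC⟩ := (hLw_mem a).1 ha
    rw [Function.comp_apply, hatomN_apply ha']
    exact hclass a ha' haC
  refine ⟨dedupG (Lw.map atomN), nodup_dedupG _, ?_, ?_, ?_⟩
  · ext A
    rw [List.mem_toFinset, mem_dedupG, List.mem_map, mem_image]
    constructor
    · rintro ⟨a, ha, rfl⟩
      obtain ⟨ha', haC⟩ := (hLw_mem a).1 ha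
      exact ⟨⟨a, ha'⟩, haC, (hatomN_apply ha').symm⟩
    · rintro ⟨i, hiC, rfl⟩
      refine ⟨i, (hLw_mem i).2 ⟨i.isLt, hiC⟩, ?_⟩
      rw [hatomN_apply i.isLt]
  · intro A hA
    rw [mem_dedupG, List.mem_map] at hA
    obtain ⟨a, ha, rfl⟩ := hA
    obtain ⟨ha', haC⟩ := (hLw_mem a).1 ha
    rw [hatomN_apply ha']
    exact ⟨atom_subset_of_splits hCs haC, ⟨_, mem_atom_self _ _⟩⟩
  · -- the program's list
    have hnb : newBlocks p (x.length + F.ancillas x.length) W (maskOf C) (subCfgs p (maskOf C)) (tabOf p C (F.ampZ x (j + 1))) =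
        (dedupL (Lw.map fun a => classOf (maskOf C) Ls a)).map fun A =>
          (A, mkTab (subCfgs p A) fun u v => capZ W (traceEntry p (maskOf C) A (tabOf p C (F.ampZ x (j + 1))) u v)) := by
      rw [hLw, hLs, ← hy₀eq]
      rfl
    rw [hnb, hmapcls, dedupL_eq_dedupG, dedupG_map_of_injective maskOf_injective, List.map_map]
    refine List.map_congr_left fun A hA => ?_
    rw [mem_dedupG, List.mem_map] at hA
    obtain ⟨a, ha, rfl⟩ := hA
    obtain ⟨ha', haC⟩ := (hLw_mem a).1 ha
    have hAC : atomN a ⊆ C := by rw [hatomN_apply ha']; exact atom_subset_of_splits hCs haC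
    have hA2 : (atomN a).card ≤ 2 * p := (card_le_card hAC).trans hC
    simp only [Function.comp_apply, blkOf, tabOf]
    congr 1
    refine mkTab_congr fun u hu v hv => ?_
    obtain ⟨yu, hyu, rfl⟩ := (mem_subCfgs_maskOf_iff hA2).1 hu
    obtain ⟨yv, hyv, rfl⟩ := (mem_subCfgs_maskOf_iff hA2).1 hv
    rw [toReg_ofReg, toReg_ofReg]
    exact capZ_traceEntry_tabOf F x hF hW hAC hC hyu hyv

/-! ### One gate of the run -/

/-- Unfolding of `roundSim` in the non-junk branch. [folklore] -/
theorem roundSim_eq_of (c : Ctx) (D : ℤ) (blocks : List Blk) (op i j : ℕ) (tch rest : List Blk) (C : Cfg)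
    (htch : touchingL op i j blocks = tch) (hrest : untouchedL op i j blocks = rest)
    (hCf : tch.foldl (fun acc b => bor acc b.1) (zeros c.N) = C)
    (hlen : tch.length = 1 ∨ tch.length = 2) (hpop : popcount C ≤ 2 * c.p) :
    roundSim c (D, blocks) (op, i, j) =
      (if op = 0 then D + D else D,
        (if op = 0 then rest.map (fun b => (b.1, doubleTab c.W b.2)) else rest) ++
          newBlocks c.p c.N c.W C (subCfgs c.p C)
            (gateTab c.W op i j (subCfgs c.p C)
              (if tch.length = 1 then (tch.getD 0 (zeros c.N, [])).2 else
                mergeTab c.W D (tch.getD 0 (zeros c.N, [])).1 (tch.getD 0 (zeros c.N, [])).2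
                  (tch.getD 1 (zeros c.N, [])).1 (tch.getD 1 (zeros c.N, [])).2 (subCfgs c.p C)))) := by
  subst htch hrest hCf
  simp only [roundSim]
  rw [if_pos ⟨hlen, hpop⟩]

/-- A duplicate-free list all of whose members are `a`, and containing `a`, is `[a]`. [folklore] -/
theorem list_eq_singleton_of_nodup {α : Type} {l : List α} {a : α} (hn : l.Nodup) (hmem : ∀ b, b ∈ l ↔ b = a) : l = [a] := by
  match l, hn, hmem with
  | [], _, hmem => exact absurd ((hmem a).2 rfl) (by simp)
  | [b], _, hmem => rw [(hmem b).1 (by simp)]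
  | b :: b' :: l, hn, hmem =>
    exfalso
    have hb := (hmem b).1 (by simp)
    have hb' := (hmem b').1 (by simp)
    subst hb hb'
    simp at hn

/-- **One gate preserves the invariant of the run.** [cite: JozsaLinden2003, §3 (proof of lemma ratpbl, Cases 1 and 2)] -/
theorem roundSim_step (hF : F.IsOracleFree) {p : ℕ} (hp : F.HasPBlockedStates p) {j W : ℕ}
    (hj : j < (F.circ x.length).gates.length) (hW : F.hExp x (j + 1) + 2 ≤ W)
    {L : List (Finset (Fin (x.length + F.ancillas x.length)))} (hLn : L.Nodup) (hLP : L.toFinset = blocksAfter F x j) :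
    ∃ L' : List (Finset (Fin (x.length + F.ancillas x.length))), L'.Nodup ∧ L'.toFinset = blocksAfter F x (j + 1) ∧
      roundSim ⟨p, x.length + F.ancillas x.length, W⟩ (2 ^ F.hExp x j, L.map (blkOf p (F.ampZ x j)))
          (gateT (F.circ x.length).gates[j]) =
        (2 ^ F.hExp x (j + 1), L'.map (blkOf p (F.ampZ x (j + 1)))) := by
  obtain ⟨op, e, hg⟩ := exists_eq_gate_of_isOracleFree (hF x.length _ (List.getElem_mem hj))
  have hP := isBlockPartition_blocksAfter hF j (F := F) (x := x)
  have hW' : F.hExp x j + 2 ≤ W := (Nat.add_le_add_right (hExp_mono F x (Nat.le_succ j)) 2).trans hW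
  obtain ⟨E, hE⟩ : ∃ E : Finset (Fin (x.length + F.ancillas x.length)),
      E = (QGate.gate op e : QGate cliffordT (x.length + F.ancillas x.length)).wires := ⟨_, rfl⟩
  have hEg : ((F.circ x.length).gates[j]).wires = E := by rw [hg, hE]
  obtain ⟨C, hCeq⟩ : ∃ C : Finset (Fin (x.length + F.ancillas x.length)), C = touchUnion (blocksAfter F x j) E := ⟨_, rfl⟩
  have hCeq' : C = touchUnion (blocksAfter F x j) ((F.circ x.length).gates[j]).wires := by rw [hEg, hCeq]
  have hC2p : C.card ≤ 2 * p := hCeq' ▸ card_touchUnion_blocksAfter_le hF hp j hj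
  have hEC : E ⊆ C := hCeq ▸ subset_touchUnion hP E
  have hCe : ∀ k, e k ∈ C := fun k => hEC (hE ▸ (mem_wires_gate_iff op e _).2 ⟨k, rfl⟩)
  -- the touching / untouched sublists
  obtain ⟨Lt, hLt⟩ : ∃ Lt : List (Finset (Fin (x.length + F.ancillas x.length))),
      Lt = L.filter fun B => decide ((B ∩ E).Nonempty) := ⟨_, rfl⟩
  obtain ⟨Lr, hLr⟩ : ∃ Lr : List (Finset (Fin (x.length + F.ancillas x.length))),
      Lr = L.filter fun B => !decide ((B ∩ E).Nonempty) := ⟨_, rfl⟩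
  have hLt_mem : ∀ B, B ∈ Lt ↔ B ∈ blocksAfter F x j ∧ (B ∩ E).Nonempty := fun B => by
    rw [hLt, List.mem_filter, decide_eq_true_eq, ← List.mem_toFinset, hLP]
  have hLr_mem : ∀ B, B ∈ Lr ↔ B ∈ blocksAfter F x j ∧ ¬(B ∩ E).Nonempty := fun B => by
    rw [hLr, List.mem_filter, Bool.not_eq_true', decide_eq_false_iff_not, ← List.mem_toFinset, hLP]
  have hLt_nd : Lt.Nodup := hLt ▸ hLn.filter _
  have hLr_nd : Lr.Nodup := hLr ▸ hLn.filter _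
  have hLt_fin : Lt.toFinset = touching (blocksAfter F x j) E := by
    ext B; rw [List.mem_toFinset, hLt_mem, touching, mem_filter]
  have hLr_fin : Lr.toFinset = blocksAfter F x j \ touching (blocksAfter F x j) E := by
    ext B; rw [List.mem_toFinset, hLr_mem, mem_sdiff, touching, mem_filter, not_and]
    exact ⟨fun ⟨h1, h2⟩ => ⟨h1, fun _ => h2⟩, fun ⟨h1, h2⟩ => ⟨h1, h2 h1⟩⟩
  have htch : touchingL (opNum op) (wireIdx op e 0) (wireIdx op e 1) (L.map (blkOf p (F.ampZ x j))) =
      Lt.map (blkOf p (F.ampZ x j)) := by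
    rw [touchingL, hLt, List.filter_map]
    congr 1
    exact List.filter_congr fun B _ => by rw [Function.comp_apply, touches_blkOf, ← hE]
  have hrest : untouchedL (opNum op) (wireIdx op e 0) (wireIdx op e 1) (L.map (blkOf p (F.ampZ x j))) =
      Lr.map (blkOf p (F.ampZ x j)) := by
    rw [untouchedL, hLr, List.filter_map]
    congr 1
    exact List.filter_congr fun B _ => by rw [Function.comp_apply, touches_blkOf, ← hE]
  have hlenT : Lt.length = (touching (blocksAfter F x j) E).card := by
    rw [← List.toFinset_card_of_nodup hLt_nd, hLt_fin]
  have hlen1 : 1 ≤ Lt.length := by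
    rw [hlenT, Nat.one_le_iff_ne_zero, Ne, card_eq_zero, ← Ne, ← nonempty_iff_ne_empty]
    exact touching_nonempty hP (hE ▸ wires_gate_nonempty op e)
  have hlen2 : Lt.length ≤ 2 := by
    rw [hlenT]
    exact (card_touching_le hP E).trans (hE ▸ card_wires_le_two _ (by exact trivial))
  have hCfold : (Lt.map (blkOf p (F.ampZ x j))).foldl (fun acc b => bor acc b.1) (zeros (x.length + F.ancillas x.length)) =
      maskOf C := by
    rw [zeros_eq_maskOf_empty, foldl_bor_blkOf, foldl_union_eq, empty_union, hLt_fin, hCeq, touchUnion]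
  have hpop : popcount (maskOf C) ≤ 2 * p := by rw [popcount_maskOf]; exact hC2p
  -- the merged table is the ideal table of `C`
  have hTC : (if (Lt.map (blkOf p (F.ampZ x j))).length = 1 then
        ((Lt.map (blkOf p (F.ampZ x j))).getD 0 (zeros (x.length + F.ancillas x.length), [])).2 else
        mergeTab W (2 ^ F.hExp x j) ((Lt.map (blkOf p (F.ampZ x j))).getD 0 (zeros (x.length + F.ancillas x.length), [])).1
          ((Lt.map (blkOf p (F.ampZ x j))).getD 0 (zeros (x.length + F.ancillas x.length), [])).2
          ((Lt.map (blkOf p (F.ampZ x j))).getD 1 (zeros (x.length + F.ancillas x.length), [])).1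
          ((Lt.map (blkOf p (F.ampZ x j))).getD 1 (zeros (x.length + F.ancillas x.length), [])).2
          (subCfgs p (maskOf C))) = tabOf p C (F.ampZ x j) := by
    have hCsup : C = Lt.toFinset.sup id := by rw [hCeq, touchUnion, hLt_fin]
    rcases Lt with _ | ⟨B₁, _ | ⟨B₂, _ | ⟨B₃, L₃⟩⟩⟩
    · simp at hlen1
    · have hC1 : C = B₁ := by rw [hCsup]; simp
      simp [blkOf, hC1]
    · have h12 : B₁ ≠ B₂ := by intro h; subst h; simp at hLt_nd
      have hB₁P : B₁ ∈ blocksAfter F x j := ((hLt_mem B₁).1 (by simp)).1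
      have hB₂P : B₂ ∈ blocksAfter F x j := ((hLt_mem B₂).1 (by simp)).1
      have hC12 : C = B₁ ∪ B₂ := by rw [hCsup]; simp [sup_eq_union]
      have hp2 : p ≤ 2 * p := by omega
      simp only [List.map_cons, List.map_nil, List.length_cons, List.length_nil, show (0 + 1 + 1 : ℕ) ≠ 1 by decide,
        if_false, List.getD_cons_zero, List.getD_cons_succ, blkOf]
      rw [hC12]
      exact mergeTab_tabOf F x hF hW' (hP.splits B₁ hB₁P) (hP.disjoint B₁ hB₁P B₂ hB₂P h12)
        ((card_le_of_mem_blocksAfter hp j B₁ hB₁P).trans hp2) ((card_le_of_mem_blocksAfter hp j B₂ hB₂P).trans hp2)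
        (hC12 ▸ hC2p)
    · simp at hlen2
  -- the new blocks
  obtain ⟨Lnew, hLnew_nd, hLnew_fin, hLnew_sub, hnb⟩ := newBlocks_eq F x hF hp hj hW hCeq'
  refine ⟨Lr ++ Lnew, ?_, ?_, ?_⟩
  · rw [List.nodup_append]
    refine ⟨hLr_nd, hLnew_nd, fun B hB A hA hBA => ?_⟩
    subst hBA
    obtain ⟨hBP, hBnt⟩ := (hLr_mem B).1 hB
    obtain ⟨hBC, hBne⟩ := hLnew_sub B hA
    have hdis : Disjoint B C := hCeq ▸ disjoint_touchUnion_of_not_mem_touching hP hBP (by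
      rw [touching, mem_filter, not_and]; exact fun _ => hBnt)
    exact hBne.ne_empty (Finset.eq_empty_of_forall_notMem fun i hi => (Finset.disjoint_left.1 hdis hi) (hBC hi))
  · rw [List.toFinset_append, hLr_fin, hLnew_fin, blocksAfter_succ F x hj, hEg, ← hCeq]
  · rw [show gateT (F.circ x.length).gates[j] = (opNum op, wireIdx op e 0, wireIdx op e 1) by rw [hg]; rfl,
      roundSim_eq_of _ _ _ _ _ _ _ _ _ htch hrest hCfold (by rw [List.length_map]; omega) hpop, hTC,
      gateTab_tabOf F x hF hj hW hg hCe hC2p, hnb, List.map_append]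
    congr 1
    · rw [hExp_succ F x hj, hg]
      cases op <;> simp [opNum, qScale, sqrtTwoExp, pow_succ, mul_two]
    · congr 1
      have key : ∀ B ∈ Lr, tabOf p B (F.ampZ x (j + 1)) =
          if opNum op = 0 then doubleTab W (tabOf p B (F.ampZ x j)) else tabOf p B (F.ampZ x j) := by
        intro B hB
        refine tabOf_ampZ_succ_of_disjoint F x hF hj hW hg fun k hk => ?_
        exact ((hLr_mem B).1 hB).2 ⟨e k, mem_inter.2 ⟨hk, hE ▸ (mem_wires_gate_iff op e _).2 ⟨k, rfl⟩⟩⟩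
      by_cases h0 : opNum op = 0
      · rw [if_pos h0, List.map_map]
        refine List.map_congr_left fun B hB => ?_
        rw [Function.comp_apply, blkOf, blkOf, key B hB, if_pos h0]
      · rw [if_neg h0]
        refine List.map_congr_left fun B hB => ?_
        rw [blkOf, blkOf, key B hB, if_neg h0]

/-! ### The initial blocks -/

/-- `deposit 0` is the zero list. [folklore] -/
theorem deposit_zero : ∀ m : Cfg, deposit 0 m = zeros m.length
  | [] => rfl
  | false :: m => by rw [deposit, deposit_zero m]; rfl
  | true :: m => by rw [deposit, Nat.zero_div, deposit_zero m]; rfl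

/-- The configurations of a singleton mask, in the program's order. [folklore] -/
theorem subCfgs_maskOf_singleton {p : ℕ} (hp : 1 ≤ p) (i : Fin N) : subCfgs p (maskOf {i}) = [zeros N, oneHot N i] := by
  have hpc : popcount (maskOf ({i} : Finset (Fin N))) = 1 := by rw [popcount_maskOf, card_singleton]
  have h4 : min (2 ^ 1) (4 ^ p) = 2 := min_eq_left (by
    calc (2 : ℕ) ^ 1 = 2 := rfl
      _ ≤ 4 ^ 1 := by norm_num
      _ ≤ 4 ^ p := Nat.pow_le_pow_right (by norm_num) hp)
  have hsub : subCfgs p (maskOf ({i} : Finset (Fin N))) = [deposit 0 (maskOf {i}), deposit 1 (maskOf {i})] := by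
    rw [subCfgs, hpc, h4]; rfl
  have h0 : deposit 0 (maskOf ({i} : Finset (Fin N))) = zeros N := by rw [deposit_zero, length_maskOf]
  have hcard : ({i} : Finset (Fin N)).card ≤ 2 * p := by rw [card_singleton]; omega
  have h1mem : deposit 1 (maskOf ({i} : Finset (Fin N))) ∈ subCfgs p (maskOf {i}) := by rw [hsub]; simp
  obtain ⟨y, hy, hy1⟩ := (mem_subCfgs_maskOf_iff hcard).1 h1mem
  have hne : deposit 1 (maskOf ({i} : Finset (Fin N))) ≠ deposit 0 (maskOf {i}) := fun h =>
    absurd (deposit_injOn _ _ _ (by rw [hpc]; norm_num) (by rw [hpc]; norm_num) h) one_ne_zero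
  rw [hsub, h0]
  congr 1
  rw [hy1]
  rw [cfg_singleton, mem_insert, mem_singleton] at hy
  rcases hy with rfl | rfl
  · exact absurd (hy1.trans (h0.trans zeros_eq_ofReg).symm) hne
  · rw [oneHot_eq_maskOf, maskOf]
    congr 2
    funext k
    by_cases hk : k = i
    · subst hk; simp
    · simp [hk, zeroCfg]

/-- **The initial blocks are the singletons with the basis-state data.** [cite: JozsaLinden2003, §3 (proof of lemma ratpbl: the input row)] -/
theorem initBlocks_eq {p : ℕ} (hp : 1 ≤ p) (w : QReg N) :
    initBlocks N (ofReg w) = (List.finRange N).map fun i => blkOf p (dpInit w) {i} := by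
  rw [initBlocks, ← List.map_coe_finRange_eq_range, List.map_map]
  refine List.map_congr_left fun i _ => ?_
  rw [Function.comp_apply, blkOf, oneHot_eq_maskOf, tabOf, subCfgs_maskOf_singleton hp, ← oneHot_eq_maskOf]
  congr 1
  refine mkTab_congr fun u hu v hv => ?_
  have hcard : ({i} : Finset (Fin N)).card ≤ 2 * p := by rw [card_singleton]; omega
  rw [← subCfgs_maskOf_singleton hp] at hu hv
  obtain ⟨yu, -, rfl⟩ := (mem_subCfgs_maskOf_iff hcard).1 hu
  obtain ⟨yv, -, rfl⟩ := (mem_subCfgs_maskOf_iff hcard).1 hv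
  rw [toReg_ofReg, toReg_ofReg, gramZ_singleton_dpInit, getD_ofReg_fin, getD_ofReg_fin, getD_ofReg_fin]

/-- The padded input as a bit list. [folklore] -/
theorem ofReg_padInput (x : List Bool) (m : ℕ) : ofReg (padInput x.get m) = x ++ zeros m := by
  rw [ofReg, padInput, List.ofFn_fin_append, List.ofFn_get, List.ofFn_const]; rfl

/-! ### The run -/

/-- **The run maintains the invariant**: after `j` gates the state is `(2^{hExp j}, L.map blkOf)` for a
duplicate-free listing `L` of `blocksAfter F x j`. [cite: JozsaLinden2003, §3 (proof of lemma ratpbl)] -/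
theorem foldl_roundSim_eq (hF : F.IsOracleFree) {p : ℕ} (hp : F.HasPBlockedStates p) (hp1 : 1 ≤ p) {W : ℕ}
    (hW : F.hExp x (F.circ x.length).gates.length + 2 ≤ W) :
    ∀ j, j ≤ (F.circ x.length).gates.length →
      ∃ L : List (Finset (Fin (x.length + F.ancillas x.length))), L.Nodup ∧ L.toFinset = blocksAfter F x j ∧
        (((F.circ x.length).gates.map gateT).take j).foldl
            (fun st g => roundSim ⟨p, x.length + F.ancillas x.length, W⟩ st g)
            (1, initBlocks (x.length + F.ancillas x.length) (ofReg (padInput x.get (F.ancillas x.length)))) =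
          (2 ^ F.hExp x j, L.map (blkOf p (F.ampZ x j)))
  | 0, _ => by
    refine ⟨(List.finRange _).map fun i => ({i} : Finset (Fin (x.length + F.ancillas x.length))), ?_, ?_, ?_⟩
    · exact (List.nodup_finRange _).map fun a b h => Finset.singleton_injective h
    · ext B; simp [blocksAfter]
    · rw [List.take_zero, List.foldl_nil, hExp_zero, pow_zero, ampZ_zero, initBlocks_eq hp1, List.map_map]
      rfl
  | j + 1, hj => by
    obtain ⟨L, hLn, hLP, hrun⟩ := foldl_roundSim_eq hF hp hp1 hW j (Nat.le_of_succ_le hj)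
    have hj' : j < (F.circ x.length).gates.length := hj
    have hWj : F.hExp x (j + 1) + 2 ≤ W := (Nat.add_le_add_right (hExp_mono F x hj) 2).trans hW
    obtain ⟨L', hL'n, hL'P, hstep⟩ := roundSim_step F x hF hp hj' hWj hLn hLP
    refine ⟨L', hL'n, hL'P, ?_⟩
    rw [← List.map_take, List.take_succ_eq_append_getElem hj', List.map_append, List.foldl_append, List.map_take, hrun,
      List.map_singleton, List.foldl_cons, List.foldl_nil, hstep]

/-! ### The read-out -/

/-- Sum over a filtered list as a sum with a test. [folklore] -/
theorem sumZ_map_filter (l : List Cfg) (q : Cfg → Bool) (f : Cfg → ZW) :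
    sumZ ((l.filter q).map f) = ((l.map fun u => if q u then f u else 0)).sum := by
  rw [sumZ_eq_sum]
  induction l with
  | nil => rfl
  | cons a l ih =>
    rw [List.filter_cons, List.map_cons, List.sum_cons]
    by_cases h : q a = true
    · rw [if_pos h, List.map_cons, List.sum_cons, ih, if_pos h]
    · rw [if_neg h, ih, if_neg h, zero_add]

/-- **The read-out of the final state is the decision bit `pDecision F x`.** [cite: JozsaLinden2003, §3 (proof of lemma ratpbl, final step)] -/
theorem readout_eq_pDecision (hF : F.IsOracleFree) {p : ℕ} (hp : F.HasPBlockedStates p) {W : ℕ}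
    (hN : 0 < x.length + F.ancillas x.length)
    {L : List (Finset (Fin (x.length + F.ancillas x.length)))} (hLn : L.Nodup)
    (hLP : L.toFinset = blocksAfter F x (F.circ x.length).gates.length) :
    readout ⟨p, x.length + F.ancillas x.length, W⟩
        (2 ^ F.hExp x (F.circ x.length).gates.length,
          L.map (blkOf p (F.ampZ x (F.circ x.length).gates.length))) = pDecision F x := by
  have hP := isBlockPartition_blocksAfter hF (F.circ x.length).gates.length (F := F) (x := x)
  obtain ⟨B₀, hB₀⟩ : ∃ B₀, B₀ = blockOf (blocksAfter F x (F.circ x.length).gates.length) ⟨0, hN⟩ := ⟨_, rfl⟩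
  have hB₀P : B₀ ∈ blocksAfter F x (F.circ x.length).gates.length := hB₀ ▸ blockOf_mem hP _
  have h0B₀ : (⟨0, hN⟩ : Fin _) ∈ B₀ := hB₀ ▸ mem_blockOf hP _
  have hB₀c : B₀.card ≤ 2 * p := (card_le_of_mem_blocksAfter hp _ B₀ hB₀P).trans (by omega)
  -- the filter picks the block of wire `0`
  have hfilter : (L.map (blkOf p (F.ampZ x (F.circ x.length).gates.length))).filter (fun b => b.1.getD 0 false) =
      [blkOf p (F.ampZ x (F.circ x.length).gates.length) B₀] := by
    rw [List.filter_map, ← List.map_singleton]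
    congr 1
    apply list_eq_singleton_of_nodup (hLn.filter _)
    intro B
    rw [List.mem_filter, Function.comp_apply, blkOf, getD_maskOf, dif_pos hN, decide_eq_true_eq, ← List.mem_toFinset, hLP]
    constructor
    · rintro ⟨hBP, h0B⟩; exact hP.eq_of_mem hBP hB₀P h0B h0B₀
    · rintro rfl; exact ⟨hB₀P, h0B₀⟩
  have hd : sumZ (((subCfgs p (maskOf B₀)).filter fun u => u.getD 0 false).map fun u =>
        lookup (tabOf p B₀ (F.ampZ x (F.circ x.length).gates.length)) (u, u)) = diagSumZ F x := by
    rw [sumZ_map_filter, sum_map_subCfgs_maskOf hB₀c, diagSumZ, dif_pos hN, ← hB₀]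
    refine sum_congr rfl fun y hy => ?_
    rw [getD_ofReg, dif_pos hN, lookup_tabOf hB₀c _ hy hy]
  simp only [readout, Nat.pos_iff_ne_zero.1 hN, if_false, hfilter, List.getD_cons_zero, blkOf, hd, pDecision, if_pos hN]

/-! ### The decision -/

/-- **The program decides `pDecision`.** For an oracle-free Clifford+`T` family whose states are all
`p`-blocked and a saturation width `W ≥ hExp + 2`, the typed simulator run on the gate list of the
`|x|`-th circuit returns the decision bit of `BoundedEntanglementReadout.lean`. [cite: JozsaLinden2003, §3 (theorem pblthm, proof of lemma ratpbl) with §2] -/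
theorem simDecide_eq_pDecision (hF : F.IsOracleFree) {p : ℕ} (hp : F.HasPBlockedStates p) {W : ℕ}
    (hW : F.hExp x (F.circ x.length).gates.length + 2 ≤ W) :
    simDecide p W x.length (F.ancillas x.length) ((F.circ x.length).gates.map gateT) x = pDecision F x := by
  by_cases hN : x.length + F.ancillas x.length = 0
  · have : pDecision F x = false := by rw [pDecision, if_neg (by omega)]
    rw [this, simDecide]
    simp only [readout, hN, if_true]
  have hN' : 0 < x.length + F.ancillas x.length := Nat.pos_of_ne_zero hN
  have hp1 : 1 ≤ p := one_le_of_hasPBlockedStates F x hp hN'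
  obtain ⟨L, hLn, hLP, hrun⟩ := foldl_roundSim_eq F x hF hp hp1 hW _ le_rfl
  rw [List.take_of_length_le (by rw [List.length_map])] at hrun
  rw [simDecide]
  rw [runSim, show x ++ zeros (F.ancillas x.length) = ofReg (padInput x.get (F.ancillas x.length)) from
    (ofReg_padInput x _).symm, hrun]
  exact readout_eq_pDecision F x hF hp hN' hLn hLP


end Family

end PSim

end Literature.Barriers.QuantumAdvantage

end
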